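import Summits.BirchSwinnertonDyer.BirchSwinnertonDyer.Theorems.PrintCFramBottomClassIndexLawFiveLeAnchorReduction
import Literature.NumberTheory.EllipticCurves.BSDRootNumberSmallConductorProofs
import Literature.NumberTheory.EllipticCurves.SzpiroLocalDataProofs
import Literature.NumberTheory.EllipticCurves.BSDConductor
import Literature.NumberTheory.EllipticCurves.ComplexMultiplicationTwistIsogenyProofs
import Summits.BirchSwinnertonDyer.Rank1Residual.P2.CMKolyvaginTamagawaIndexOddHeegnerBases
import Literature.NumberTheory.DiophantineGeometry.ConductorExponentZeroProofs
import Literature.NumberTheory.DiophantineGeometry.LocalReductionFiniteBadPlacesProofs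
import Literature.NumberTheory.DiophantineGeometry.LocalReductionHasMultiplicativeReductionAtProofs
import HarnessLib

/-!
# Crux `PrintCFram.BottomClassIndexLawFiveLe` (stmt-BirchSwinnertonDyer-20372), line `relative-anchor-transfer`
# (sha16 72dde5b866033574), stub `stub_unitAnchor`: FOUR of the seven class anchors are IN PRINT —
# Gross's curves `A(11) = 121b1`, `A(19) = 361a1`, `A(43) = 1849a1`, `A(67) = 4489a1` have conductor
# `p² < 5000`, so Creutz–Miller 2012 / Miller 2011 / Miller–Stoll 2013 (`BSD(E, p)` for every `E/ℚ` with
# `r_an ≤ 1` and `N_E < 5000`, tree named facts `bsdp_of_{ir}reducible_of_conductor_lt`) give `BSDp A(p) p`,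
# hence `S_open(A(p), p)`; the conductors `N(A(p)) = p²` are COMPUTED here in the kernel (cell
# `bsd-print-cfram`, width seat `bsd-line-cfram-p1-w2`; THEOREMS ONLY, `--supports` 20372; CONDITIONAL on the
# displayed named facts and on ONE analytic binder `r_an(A(p)) = 1` per curve; BSD is not proved by any of this)

HONEST FRAMING. Fourth file of the anchor side (`…AnchorReduction` p606463: stub ⟸ seven anchors / seven
rank-one `BSD_p` certificates; `…AnchorSeven` p606994: the `p = 7` classes at Route U's price;
`…AnchorUnitStratum` p607216: unit members by descent). Correction of this seat's earlier reading («`p ≥ 11`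
not in print»): for `p ∈ {11, 19, 43, 67}` the natural anchor `A(p)` (the tree's minimal models `cm11`, `cm19`,
`cm43`, `cm67`, Silverman *AT* App. A §3) has conductor `p² ∈ {121, 361, 1849, 4489} < 5000`, inside the range
of the PRINTED computer-assisted theorem «full BSD for `E/ℚ` with `r_an(E) ≤ 1` and `N_E < 5000`»
(Creutz–Miller 2012 Thm. 1.1 = Miller 2011 Thm. 1.2 + Miller–Stoll 2013 Thm. 9.1 + Lawson–Wuthrich 2016 §5;
tree named facts `bsdp_of_irreducible_of_conductor_lt`, `bsdp_of_reducible_of_conductor_lt`, bsd.S31).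
So, granted those two facts and Cassels / entire continuation / GZK (route item S4), the anchor of each of
the four classes `(11, −32768)`, `(19, −884736)`, `(43, −884736000)`, `(67, −147197952000)` holds modulo ONE
displayed analytic binder `r_an(A(p)) = 1` (root number `−1` for `p ≡ 3 (mod 8)`; Cremona's tables;
Miller–Yang 2000 — not a kernel theorem). What is computed HERE: §1 a generic conductor lemma for integer
models with `Δ = −p³`, `p ∣ c₄`, `p⁴ ∤ c₄`, `p ≥ 5` (`f_p = 2` additive, `f_q = 0` for `q ≠ p`; Silverman
*ATAEC* IV.10.2) and the four instances `conductorNorm_cm11 = 121`, `…_cm19 = 361`, `…_cm43 = 1849`,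
`…_cm67 = 4489` (global minimality of the four models is the sibling cell's
`P2.OddHeegnerTwists.isGloballyMinimal_cmP`); §2 the four
anchors; §3 `stub_unitAnchor` ⟸ {the five named facts} + {`r_an(cmP) = 1`, four binders} + the displayed
anchors of the three remaining classes `(7, −3375)`, `(7, 16581375)` (booked at Route U's price in
`…AnchorSeven`) and `(163, −262537412640768000)` — `A(163) = 26569a1` has conductor `26569 > 5000`: THE ONE
CLASS OF THE ANCHOR STUB BEYOND PRINT (cell `bsd-cm`'s planned Route U^{(163)}: Kriz–Li 2019 Thm. 1.20 /
Rem. 1.21 at `p = 163` with `K″ = ℚ(√−7)` + Buhler–Gross 1985 Ch. II at `p = 163`, both printed for general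
`p`, + in-kernel Bernoulli certificates; not started). beyond-print theorem: NO.

References: [CreutzMiller2012] Thm. 1.1; [Miller2011LMS] Thm. 1.2, Def. 1.1; [MillerStoll2012] Thm. 9.1;
[LawsonWuthrich2016] §5; [Silverman1994] IV.10.2; [SilvermanAEC2009] VII.1 Rem. 1.1, VII.5.1;
[SilvermanATAEC1994] App. A §3; [Cremona1997] Table 1 (121b1, 361a1, 1849a1, 4489a1);
[Cassels1965ArithmeticVIII]; [BurungaleKobayashiNakamuraOta2026] §1.4 (shape only).
-/

noncomputable section

-- summit-side namespace `Summit.BirchSwinnertonDyer.BirchSwinnertonDyer.…` (single-conjunct summit, D-0017 layout)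
set_option linter.dupNamespace false

open scoped Classical

open WeierstrassCurve IsDedekindDomain NumberField Rat.HeightOneSpectrum
  Literature.NumberTheory.EllipticCurves Literature.NumberTheory.EllipticCurves.Rank1Residual
  Summit.BirchSwinnertonDyer.Rank1Residual
  Summit.BirchSwinnertonDyer.Rank1Residual.X12.O11
  Summit.BirchSwinnertonDyer.BirchSwinnertonDyer.Theorems.RamifiedSevenEllipticUnits

namespace Summit.BirchSwinnertonDyer.BirchSwinnertonDyer.Theorems.PrintCFram.AnchorReduction

/-! ## §1 Conductor `p²` of an integer model with `Δ = −p³`, `p ∥∼ c₄` (`p ≥ 5`), and the four Gross curves -/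

/-- `f_p = 2` for an integer model with `p ∣ Δ`, `p ∣ c₄`, `p⁴ ∤ c₄`, `p ≥ 5`: the model is minimal at `p`
(`ord_p c₄ < 4`) with additive reduction (`p ∣ Δ`, `p ∣ c₄`, Silverman VII.5.1 (c)), and an additive prime
`p ≥ 5` has conductor exponent `2` (`conductorExponent_eq_two_of_five_le_of_isElliptic`).
[cite: Silverman1994, IV.10.2 (c)] [cite: SilvermanAEC2009, VII.1 Remark 1.1 and VII.5.1] -/
theorem conductorExponent_baseChange_int_eq_two (W₀ : WeierstrassCurve ℤ) [(W₀.baseChange ℚ).IsElliptic]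
    {p : ℕ} (hp : p.Prime) (h5 : 5 ≤ p) (hΔ : (p : ℤ) ∣ W₀.Δ) (hc₄ : (p : ℤ) ∣ W₀.c₄)
    (hc₄' : ¬ (p : ℤ) ^ 4 ∣ W₀.c₄) :
    (W₀.baseChange ℚ).conductorExponent ((primesEquiv (R := ℤ)).symm ⟨p, hp⟩) = 2 := by
  set v := (primesEquiv (R := ℤ)).symm ⟨p, hp⟩ with hv
  have hgen : natGenerator v = p :=
    Literature.NumberTheory.EllipticCurves.Rat.natGenerator_primesEquiv_symm ⟨p, hp⟩
  have hmin : (W₀.baseChange ℚ).IsMinimalAt v := by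
    refine isMinimalAt_of_lt_valuation_c₄ (isIntegralAt_baseChange v W₀) ?_
    rw [baseChange_int_c₄]
    exact (Literature.NumberTheory.EllipticCurves.Rat.exp_lt_valuation_intCast_iff v W₀.c₄ 4).mpr
      (by rw [hgen]; exact hc₄')
  refine conductorExponent_eq_two_of_five_le_of_isElliptic _ v (by rw [hgen]; exact h5)
    ((hasAdditiveReductionAt_iff_of_isMinimalAt hmin).mpr ⟨?_, ?_⟩)
  · rw [baseChange_int_Δ, Literature.NumberTheory.EllipticCurves.Rat.valuation_intCast_lt_one_iff, hgen]
    exact hΔ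
  · rw [baseChange_int_c₄, Literature.NumberTheory.EllipticCurves.Rat.valuation_intCast_lt_one_iff, hgen]
    exact hc₄

/-- `f_q = 0` for an integer model at a prime `q ∤ Δ`: `q`-unit discriminant, good reduction (Silverman
VII.5.1 (a); `conductorExponent_eq_zero_iff`). [cite: Silverman1994, IV.10.2 (a)] [cite: SilvermanAEC2009, VII.5.1 (a)] -/
theorem conductorExponent_baseChange_int_eq_zero (W₀ : WeierstrassCurve ℤ) [(W₀.baseChange ℚ).IsElliptic]
    {q : ℕ} (hq : q.Prime) (hΔ : ¬ (q : ℤ) ∣ W₀.Δ) :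
    (W₀.baseChange ℚ).conductorExponent ((primesEquiv (R := ℤ)).symm ⟨q, hq⟩) = 0 := by
  set v := (primesEquiv (R := ℤ)).symm ⟨q, hq⟩ with hv
  have hgen : natGenerator v = q :=
    Literature.NumberTheory.EllipticCurves.Rat.natGenerator_primesEquiv_symm ⟨q, hq⟩
  refine (conductorExponent_eq_zero_iff_holds v _).mpr
    (hasGoodReductionAt_of_valuation_Δ_eq_one_holds v _ (isIntegralAt_baseChange v W₀) ?_)
  rw [baseChange_int_Δ, Literature.NumberTheory.EllipticCurves.Rat.valuation_intCast_eq_one_iff, hgen]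
  exact hΔ

/-- **`N = p²` for an integer model with `Δ = −p³`, `p ∣ c₄`, `p⁴ ∤ c₄`, `p ≥ 5`** (`N = ∏ q^{f_q}` with
`f_p = 2`, `f_q = 0` for `q ≠ p`). The shape of Gross's curves `A(p)` in Silverman's table (`Δ = −p³`).
[cite: Silverman1994, IV.10.2] [cite: SilvermanATAEC1994, App. A §3] -/
theorem conductorNorm_baseChange_int_eq_sq (W₀ : WeierstrassCurve ℤ) [(W₀.baseChange ℚ).IsElliptic]
    {p : ℕ} (hp : p.Prime) (h5 : 5 ≤ p) (hΔ : W₀.Δ = -(p : ℤ) ^ 3) (hc₄ : (p : ℤ) ∣ W₀.c₄)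
    (hc₄' : ¬ (p : ℤ) ^ 4 ∣ W₀.c₄) : (W₀.baseChange ℚ).conductorNorm ℤ = p ^ 2 := by
  refine Nat.eq_of_factorization_eq ((W₀.baseChange ℚ).conductorNorm_pos_holds).ne' (pow_ne_zero 2 hp.ne_zero)
    fun q ↦ ?_
  by_cases hq : q.Prime
  swap
  · rw [Nat.factorization_eq_zero_of_not_prime _ hq, Nat.factorization_eq_zero_of_not_prime _ hq]
  rw [show q = ((⟨q, hq⟩ : Nat.Primes) : ℕ) from rfl, factorization_conductorNorm_primesEquiv_symm,
    Nat.factorization_pow, Nat.Prime.factorization hp]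
  simp only [Finsupp.coe_smul, Pi.smul_apply, Finsupp.single_apply, smul_eq_mul]
  by_cases hpq : p = q
  · subst hpq
    rw [if_pos rfl, mul_one]
    exact conductorExponent_baseChange_int_eq_two W₀ hp h5
      (by rw [hΔ, dvd_neg]; exact dvd_pow_self _ (by norm_num)) hc₄ hc₄'
  · rw [if_neg hpq, mul_zero]
    refine conductorExponent_baseChange_int_eq_zero W₀ hq ?_
    rw [hΔ, dvd_neg]
    intro h
    have h1 : (q : ℤ) ∣ (p : ℤ) := Int.Prime.dvd_pow' hq h
    have h2 : q ∣ p := by exact_mod_cast h1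
    exact hpq ((Nat.prime_dvd_prime_iff_eq hq hp).mp h2).symm

/-- `A(11) = cm11 = [0, −1, 1, −7, 10]` (`121b1`) is the base change of its integer model. [folklore] -/
theorem cm11_eq_baseChange_int : cm11 = (⟨0, -1, 1, -7, 10⟩ : WeierstrassCurve ℤ).baseChange ℚ := by
  ext <;> simp [WeierstrassCurve.baseChange, WeierstrassCurve.map]

/-- `A(19) = cm19 = [0, 0, 1, −38, 90]` (`361a1`) is the base change of its integer model. [folklore] -/
theorem cm19_eq_baseChange_int : cm19 = (⟨0, 0, 1, -38, 90⟩ : WeierstrassCurve ℤ).baseChange ℚ := by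
  ext <;> simp [WeierstrassCurve.baseChange, WeierstrassCurve.map]

/-- `A(43) = cm43 = [0, 0, 1, −860, 9707]` (`1849a1`) is the base change of its integer model. [folklore] -/
theorem cm43_eq_baseChange_int : cm43 = (⟨0, 0, 1, -860, 9707⟩ : WeierstrassCurve ℤ).baseChange ℚ := by
  ext <;> simp [WeierstrassCurve.baseChange, WeierstrassCurve.map]

/-- `A(67) = cm67 = [0, 0, 1, −7370, 243528]` (`4489a1`) is the base change of its integer model. [folklore] -/
theorem cm67_eq_baseChange_int :
    cm67 = (⟨0, 0, 1, -7370, 243528⟩ : WeierstrassCurve ℤ).baseChange ℚ := by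
  ext <;> simp [WeierstrassCurve.baseChange, WeierstrassCurve.map]

/-- **`N(121b1) = 121`** (`Δ = −11³`, `c₄ = 352 = 2⁵·11`). [cite: Cremona1997, Table 1 (curve 121b1)]
[cite: Silverman1994, IV.10.2] -/
theorem conductorNorm_cm11 : cm11.conductorNorm ℤ = 121 := by
  haveI : ((⟨0, -1, 1, -7, 10⟩ : WeierstrassCurve ℤ).baseChange ℚ).IsElliptic := by
    rw [← cm11_eq_baseChange_int]; infer_instance
  rw [cm11_eq_baseChange_int, show (121 : ℕ) = 11 ^ 2 by norm_num]
  exact conductorNorm_baseChange_int_eq_sq _ (by norm_num) (by norm_num) (by decide) (by decide) (by decide)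

/-- **`N(361a1) = 361`** (`Δ = −19³`, `c₄ = 1824 = 2⁵·3·19`). [cite: Cremona1997, Table 1 (curve 361a1)]
[cite: Silverman1994, IV.10.2] -/
theorem conductorNorm_cm19 : cm19.conductorNorm ℤ = 361 := by
  haveI : ((⟨0, 0, 1, -38, 90⟩ : WeierstrassCurve ℤ).baseChange ℚ).IsElliptic := by
    rw [← cm19_eq_baseChange_int]; infer_instance
  rw [cm19_eq_baseChange_int, show (361 : ℕ) = 19 ^ 2 by norm_num]
  exact conductorNorm_baseChange_int_eq_sq _ (by norm_num) (by norm_num) (by decide) (by decide) (by decide)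

/-- **`N(1849a1) = 1849`** (`Δ = −43³`, `c₄ = 41280 = 2⁶·3·5·43`). [cite: Cremona1997, Table 1 (curve 1849a1)]
[cite: Silverman1994, IV.10.2] -/
theorem conductorNorm_cm43 : cm43.conductorNorm ℤ = 1849 := by
  haveI : ((⟨0, 0, 1, -860, 9707⟩ : WeierstrassCurve ℤ).baseChange ℚ).IsElliptic := by
    rw [← cm43_eq_baseChange_int]; infer_instance
  rw [cm43_eq_baseChange_int, show (1849 : ℕ) = 43 ^ 2 by norm_num]
  exact conductorNorm_baseChange_int_eq_sq _ (by norm_num) (by norm_num) (by decide) (by decide) (by decide)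

/-- **`N(4489a1) = 4489`** (`Δ = −67³`, `c₄ = 353760 = 2⁵·3·5·11·67`). [cite: Cremona1997, Table 1 (curve 4489a1)]
[cite: Silverman1994, IV.10.2] -/
theorem conductorNorm_cm67 : cm67.conductorNorm ℤ = 4489 := by
  haveI : ((⟨0, 0, 1, -7370, 243528⟩ : WeierstrassCurve ℤ).baseChange ℚ).IsElliptic := by
    rw [← cm67_eq_baseChange_int]; infer_instance
  rw [cm67_eq_baseChange_int, show (4489 : ℕ) = 67 ^ 2 by norm_num]
  exact conductorNorm_baseChange_int_eq_sq _ (by norm_num) (by norm_num) (by decide) (by decide) (by decide)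

/-! ## §2 The four printed anchors: `BSD_p(A(p))` from `N(A(p)) = p² < 5000`, then `S_open(A(p), p)` -/

/-- **A globally minimal CM curve of analytic rank one, CM-ramified `p`, and conductor `< 5000` is an anchor**,
granted the printed `N < 5000` theorem (its two `p`-part named facts), Cassels, entire continuation, GZK:
`BSDp W₀ p` by `forall_bsdp_of_conductor_lt`, then `S_open(W₀, p)` by
`RubinFormulaZpBsdp.ramifiedCMRubinFormulaAtZp_of_bsdp`. CONDITIONAL on the five displayed named facts.
[cite: CreutzMiller2012, Thm. 1.1] [cite: Miller2011LMS, Thm. 1.2 and Def. 1.1] [cite: MillerStoll2012, Thm. 9.1]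
[cite: Cassels1965ArithmeticVIII] -/
theorem rubinFormulaAtZp_of_conductor_lt (hirr : bsdp_of_irreducible_of_conductor_lt)
    (hred : bsdp_of_reducible_of_conductor_lt) (hCassels : bsdRHS_eq_of_isIsogenous)
    (hmod : hasEntireLFunction_rat) (hGZK : rank_eq_analyticRank_of_analyticRank_le_one)
    {p : ℕ} [Fact p.Prime] {W₀ : WeierstrassCurve ℚ} [W₀.IsElliptic] [W₀.IsGloballyMinimal]
    (hN : W₀.conductorNorm ℤ < 5000) (hr : W₀.analyticRank = 1) : RamifiedCMRubinFormulaAtZp W₀ p :=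
  RubinFormulaZpBsdp.ramifiedCMRubinFormulaAtZp_of_bsdp hCassels hmod hGZK hr.le
    (forall_bsdp_of_conductor_lt hirr hred W₀ hr.le hN p (Fact.out))

/-- **Anchor of class `(11, −32768)` in print**: `A(11) = cm11 = 121b1` (`N = 121 < 5000`), modulo the
five named facts and the ONE binder `r_an(cm11) = 1`. [cite: CreutzMiller2012, Thm. 1.1]
[cite: MillerStoll2012, Thm. 9.1] [cite: Cremona1997, Table 1 (curve 121b1)] -/
theorem anchor_eleven_of_conductor_lt [Fact (Nat.Prime 11)] (hirr : bsdp_of_irreducible_of_conductor_lt)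
    (hred : bsdp_of_reducible_of_conductor_lt) (hCassels : bsdRHS_eq_of_isIsogenous)
    (hmod : hasEntireLFunction_rat) (hGZK : rank_eq_analyticRank_of_analyticRank_le_one)
    (hr : cm11.analyticRank = 1) :
    ∃ (W₀ : WeierstrassCurve ℚ) (_ : W₀.IsElliptic) (_ : W₀.IsGloballyMinimal),
      W₀.j = -32768 ∧ W₀.analyticRank = 1 ∧ RamifiedCMRubinFormulaAtZp W₀ 11 :=
  haveI := P2.OddHeegnerTwists.isGloballyMinimal_cm11
  ⟨cm11, inferInstance, P2.OddHeegnerTwists.isGloballyMinimal_cm11, j_cm11, hr,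
    rubinFormulaAtZp_of_conductor_lt hirr hred hCassels hmod hGZK (by rw [conductorNorm_cm11]; norm_num) hr⟩

/-- **Anchor of class `(19, −884736)` in print**: `A(19) = cm19 = 361a1` (`N = 361 < 5000`), modulo the five
named facts and the binder `r_an(cm19) = 1`. [cite: CreutzMiller2012, Thm. 1.1] [cite: MillerStoll2012, Thm. 9.1]
[cite: Cremona1997, Table 1 (curve 361a1)] -/
theorem anchor_nineteen_of_conductor_lt [Fact (Nat.Prime 19)] (hirr : bsdp_of_irreducible_of_conductor_lt)
    (hred : bsdp_of_reducible_of_conductor_lt) (hCassels : bsdRHS_eq_of_isIsogenous)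
    (hmod : hasEntireLFunction_rat) (hGZK : rank_eq_analyticRank_of_analyticRank_le_one)
    (hr : cm19.analyticRank = 1) :
    ∃ (W₀ : WeierstrassCurve ℚ) (_ : W₀.IsElliptic) (_ : W₀.IsGloballyMinimal),
      W₀.j = -884736 ∧ W₀.analyticRank = 1 ∧ RamifiedCMRubinFormulaAtZp W₀ 19 :=
  haveI := P2.OddHeegnerTwists.isGloballyMinimal_cm19
  ⟨cm19, inferInstance, P2.OddHeegnerTwists.isGloballyMinimal_cm19, j_cm19, hr,
    rubinFormulaAtZp_of_conductor_lt hirr hred hCassels hmod hGZK (by rw [conductorNorm_cm19]; norm_num) hr⟩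

/-- **Anchor of class `(43, −884736000)` in print**: `A(43) = cm43 = 1849a1` (`N = 1849 < 5000`), modulo the
five named facts and the binder `r_an(cm43) = 1`. [cite: CreutzMiller2012, Thm. 1.1] [cite: MillerStoll2012, Thm. 9.1]
[cite: Cremona1997, Table 1 (curve 1849a1)] -/
theorem anchor_fortythree_of_conductor_lt [Fact (Nat.Prime 43)] (hirr : bsdp_of_irreducible_of_conductor_lt)
    (hred : bsdp_of_reducible_of_conductor_lt) (hCassels : bsdRHS_eq_of_isIsogenous)
    (hmod : hasEntireLFunction_rat) (hGZK : rank_eq_analyticRank_of_analyticRank_le_one)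
    (hr : cm43.analyticRank = 1) :
    ∃ (W₀ : WeierstrassCurve ℚ) (_ : W₀.IsElliptic) (_ : W₀.IsGloballyMinimal),
      W₀.j = -884736000 ∧ W₀.analyticRank = 1 ∧ RamifiedCMRubinFormulaAtZp W₀ 43 :=
  haveI := P2.OddHeegnerTwists.isGloballyMinimal_cm43
  ⟨cm43, inferInstance, P2.OddHeegnerTwists.isGloballyMinimal_cm43, j_cm43, hr,
    rubinFormulaAtZp_of_conductor_lt hirr hred hCassels hmod hGZK (by rw [conductorNorm_cm43]; norm_num) hr⟩

/-- **Anchor of class `(67, −147197952000)` in print**: `A(67) = cm67 = 4489a1` (`N = 4489 < 5000`), modulo the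
five named facts and the binder `r_an(cm67) = 1`. [cite: CreutzMiller2012, Thm. 1.1] [cite: MillerStoll2012, Thm. 9.1]
[cite: Cremona1997, Table 1 (curve 4489a1)] -/
theorem anchor_sixtyseven_of_conductor_lt [Fact (Nat.Prime 67)] (hirr : bsdp_of_irreducible_of_conductor_lt)
    (hred : bsdp_of_reducible_of_conductor_lt) (hCassels : bsdRHS_eq_of_isIsogenous)
    (hmod : hasEntireLFunction_rat) (hGZK : rank_eq_analyticRank_of_analyticRank_le_one)
    (hr : cm67.analyticRank = 1) :
    ∃ (W₀ : WeierstrassCurve ℚ) (_ : W₀.IsElliptic) (_ : W₀.IsGloballyMinimal),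
      W₀.j = -147197952000 ∧ W₀.analyticRank = 1 ∧ RamifiedCMRubinFormulaAtZp W₀ 67 :=
  haveI := P2.OddHeegnerTwists.isGloballyMinimal_cm67
  ⟨cm67, inferInstance, P2.OddHeegnerTwists.isGloballyMinimal_cm67, j_cm67, hr,
    rubinFormulaAtZp_of_conductor_lt hirr hred hCassels hmod hGZK (by rw [conductorNorm_cm67]; norm_num) hr⟩

/-! ## §3 `stub_unitAnchor` with four classes in print: what is left is `p = 7` (Route U) and `p = 163` -/

/-- **`stub_unitAnchor` ⟸ five named facts + four analytic binders + the three remaining displayed anchors.**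
Granted the printed `N < 5000` theorem (`bsdp_of_irreducible_of_conductor_lt`, `bsdp_of_reducible_of_conductor_lt`),
Cassels, entire continuation and GZK, and the four binders `r_an(A(p)) = 1` for `p ∈ {11, 19, 43, 67}`, the
registered stub `stub_unitAnchor` of line `relative-anchor-transfer` holds VERBATIM as soon as the three
remaining classes have anchors: `(7, −3375)`, `(7, 16581375)` (`…AnchorSeven`: Route U's member `49a1^{(−11)}`
at Route U's price) and `(163, −262537412640768000)` — the ONLY class with no printed anchor (`N(A(163)) =
26569 > 5000`; cell `bsd-cm`'s Route U^{(163)} plan). CONDITIONAL on everything displayed; nothing certified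
here. [cite: CreutzMiller2012, Thm. 1.1] [cite: MillerStoll2012, Thm. 9.1] [cite: Miller2011LMS, Def. 1.1]
[cite: Cassels1965ArithmeticVIII] -/
theorem stub_unitAnchor_of_conductor_lt_of_anchors_seven_onesixtythree
    (hirr : bsdp_of_irreducible_of_conductor_lt) (hred : bsdp_of_reducible_of_conductor_lt)
    (hCassels : bsdRHS_eq_of_isIsogenous) (hmod : hasEntireLFunction_rat)
    (hGZK : rank_eq_analyticRank_of_analyticRank_le_one)
    (hr11 : cm11.analyticRank = 1) (hr19 : cm19.analyticRank = 1) (hr43 : cm43.analyticRank = 1)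
    (hr67 : cm67.analyticRank = 1)
    (h7a : ∀ [Fact (Nat.Prime 7)], ∃ (W₀ : WeierstrassCurve ℚ) (_ : W₀.IsElliptic) (_ : W₀.IsGloballyMinimal),
      W₀.j = -3375 ∧ W₀.analyticRank = 1 ∧ RamifiedCMRubinFormulaAtZp W₀ 7)
    (h7b : ∀ [Fact (Nat.Prime 7)], ∃ (W₀ : WeierstrassCurve ℚ) (_ : W₀.IsElliptic) (_ : W₀.IsGloballyMinimal),
      W₀.j = 16581375 ∧ W₀.analyticRank = 1 ∧ RamifiedCMRubinFormulaAtZp W₀ 7)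
    (h163 : ∀ [Fact (Nat.Prime 163)], ∃ (W₀ : WeierstrassCurve ℚ) (_ : W₀.IsElliptic)
      (_ : W₀.IsGloballyMinimal),
      W₀.j = -262537412640768000 ∧ W₀.analyticRank = 1 ∧ RamifiedCMRubinFormulaAtZp W₀ 163) :
    ∀ (W : WeierstrassCurve ℚ) [W.IsElliptic] [W.IsGloballyMinimal] (p : ℕ) [Fact p.Prime],
      W.HasCM → CMRamified W p → 5 ≤ p → W.analyticRank = 1 →
      ∃ (W₀ : WeierstrassCurve ℚ) (_ : W₀.IsElliptic) (_ : W₀.IsGloballyMinimal),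
        W₀.HasCM ∧ CMRamified W₀ p ∧ W₀.analyticRank = 1 ∧ W₀.j = W.j ∧ RamifiedCMRubinFormulaAtZp W₀ p :=
  stub_unitAnchor_of_anchors h7a h7b
    (fun {_} => anchor_eleven_of_conductor_lt hirr hred hCassels hmod hGZK hr11)
    (fun {_} => anchor_nineteen_of_conductor_lt hirr hred hCassels hmod hGZK hr19)
    (fun {_} => anchor_fortythree_of_conductor_lt hirr hred hCassels hmod hGZK hr43)
    (fun {_} => anchor_sixtyseven_of_conductor_lt hirr hred hCassels hmod hGZK hr67) h163

end Summit.BirchSwinnertonDyer.BirchSwinnertonDyer.Theorems.PrintCFram.AnchorReduction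

end
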